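import Mathlib
import HarnessLib
import Summits.Ventures.LatticeQCDFlow.Exactness.TransformedHMC

/-!
# Refresh, update, forget: auxiliary-variable updates are exact — and THMC as the code runs it

HONEST FRAMING: exact (Metropolis-corrected) sampling algorithms for lattice gauge theory;
figures of merit are autocorrelation/cost numbers at stated couplings and volumes; no
continuum-physics claim.

Venture `LatticeQCDFlow` (cell pub-lqcd), topic `Exactness`; FANOUT row 7 (`s0-cpn-null`, S0-D1:
trivializing map inside HMC vs HMC).  NEW WORK of the cell over Mathlib's kernel library
(`Kernel.id ×ₖ Kernel.const`, `Measure.compProd_const`, `Measure.fst_prod`) and the tree's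
`Exactness/TransformedKernel.lean` / `TransformedHMC.lean` / `InvolutiveMetropolis.lean` /
`RefreshScan.lean` (`invariant_smul`); nothing here is cited as a fact.  Printed counterparts,
named only: Duane–Kennedy–Pendleton–Roweth 1987 (HMC: momentum heat bath + MD + accept/reject),
Lüscher 2010 §2.3–§2.4, Engel–Schaefer 2011 §2 (THMC), Andersen 1980 / Neal 2011 (auxiliary
momenta).

Row 2's `Phi4HMCExact.lean` marginalises the momenta of HMC on `ℝ^Λ` in integral form; row 9's
`RefreshScan.lean` refreshes one SITE of a product configuration.  This file is the kernel-level
statement for a general AUXILIARY variable, which is what THMC (and HMC on any phase space) uses: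

* `augment μP : Kernel Ω (Ω × P)` — attach a fresh auxiliary variable `π ∼ μP` to the state
  (`u ↦ δ_u ⊗ μP`); `augment_comp` — `augment μP ∘ₘ μ = μ ⊗ μP`.
* `refreshUpdate κ μP : Kernel Ω Ω` — ONE HMC-TYPE UPDATE of the configuration: refresh
  `π ∼ μP`, apply the phase-space update `κ`, forget `π`; `refreshUpdate_apply'`
  (`K(u, A) = ∫ κ((u, π), A × P) μP(dπ)`); Markov if `κ` is and `μP` is a probability law.
* **`refreshUpdate_invariant`** — if `κ` leaves `μ ⊗ μP` invariant (`μP` a probability law) then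
  `refreshUpdate κ μP` leaves `μ` invariant; **`refreshUpdate_isReversible`** — if `κ` is
  `μ ⊗ μP`-reversible then `refreshUpdate κ μP` is `μ`-reversible (sets `A × P`, `B × P`).
  No structure of `κ` is used: MD + accept/reject (`involMH`), several MD proposals, partial
  refreshment composed inside `κ`, tempering in `π`, … .  `conjKernel_refreshUpdate` — reporting
  through a map `F` of the configuration commutes with refresh–update–forget (`F × id` on phase
  space: the momenta are not transformed).
* `invariant_smul_iff` — invariance for `c • μ` and for `μ` are equivalent (`c ≠ 0, ∞`): the
  un-normalised Boltzmann weight `e^{−H} = e^{−S}e^{−T}` and `(e^{−S}·vol) ⊗ μP` with the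
  normalised momentum law `μP = Z_T⁻¹ e^{−T}·volP` differ by the constant `Z_T`.
* **`hmc_config_exact`** — the HMC configuration update built from the tree's skeleton: for ANY
  measurable `vol ⊗ volP`-preserving involution `Φ` and Hamiltonian `H(u, π) = S(u) + T(π)` with
  `0 < Z_T = ∫ e^{−T} dvolP < ∞`, `refreshUpdate (involMH Φ _ H) (Z_T⁻¹ e^{−T}·volP)` leaves
  `e^{−S}·vol` invariant.
* **`thmc_config_exact`** — THMC AS THE CODE RUNS IT: on the `V`-variables refresh `π`, integrate
  the modified Hamiltonian `H̃ = (S∘F − log J) + T` with any volume-preserving reversible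
  integrator, accept/reject, and REPORT `U = F V`: the resulting configuration chain leaves
  `e^{−S(U)}·vol` invariant (`hmc_config_exact` for `S̃` + `thmc_exact`).

Not here: irreducibility / ergodicity of the configuration chain, partial momentum refreshment as
a named scheme, and the Liouville measure of a cotangent bundle (on `G^E` the momenta live in the
Lie algebra; `P`, `volP` are abstract here).
-/

namespace Summit.Ventures.LatticeQCDFlow.Exactness

open MeasureTheory ProbabilityTheory ProbabilityTheory.Kernel
open scoped ENNReal

variable {Ω P : Type*} [MeasurableSpace Ω] [MeasurableSpace P]

/-! ## Attaching and forgetting an auxiliary variable -/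

/-- Attach a fresh auxiliary variable `π ∼ μP` to the state: `u ↦ δ_u ⊗ μP`. -/
noncomputable def augment (μP : Measure P) : Kernel Ω (Ω × P) :=
  Kernel.id ×ₖ Kernel.const Ω μP

/-- `augment μP u = δ_u ⊗ μP`. -/
theorem augment_apply (μP : Measure P) [SFinite μP] (u : Ω) :
    augment μP u = (Measure.dirac u).prod μP := by
  rw [augment, Kernel.prod_apply, Kernel.id_apply, Kernel.const_apply]

/-- `augment μP ∘ₘ μ = μ ⊗ μP`: refreshing the auxiliary variable of a `μ`-distributed state gives
the product law. -/
theorem augment_comp (μ : Measure Ω) [SFinite μ] (μP : Measure P) [SFinite μP] :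
    augment μP ∘ₘ μ = μ.prod μP := by
  rw [augment, ← Measure.compProd_eq_comp_prod, Measure.compProd_const]

/-- `augment μP` is a Markov kernel for a probability law `μP`. -/
instance augment.isMarkovKernel (μP : Measure P) [IsProbabilityMeasure μP] :
    IsMarkovKernel (augment μP : Kernel Ω (Ω × P)) := by
  unfold augment; infer_instance

/-- **One HMC-type update of the configuration**: refresh `π ∼ μP`, apply the phase-space update
`κ`, forget `π`. -/
noncomputable def refreshUpdate (κ : Kernel (Ω × P) (Ω × P)) (μP : Measure P) : Kernel Ω Ω :=
  Kernel.map (κ ∘ₖ augment μP) Prod.fst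

/-- `refreshUpdate κ μP u A = ∫ κ((u, π), A × P) μP(dπ)` (as the preimage `Prod.fst ⁻¹' A`). -/
theorem refreshUpdate_apply' (κ : Kernel (Ω × P) (Ω × P)) (μP : Measure P) [SFinite μP] (u : Ω)
    {A : Set Ω} (hA : MeasurableSet A) :
    refreshUpdate κ μP u A = ∫⁻ π, κ (u, π) (Prod.fst ⁻¹' A) ∂μP := by
  rw [refreshUpdate, Kernel.map_apply' _ measurable_fst _ hA,
    Kernel.comp_apply' _ _ _ (measurable_fst hA), augment_apply, Measure.dirac_prod,
    lintegral_map ((Kernel.measurable_coe κ (measurable_fst hA))) measurable_prodMk_left]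

/-- The configuration update is Markov when `κ` is and `μP` is a probability law. -/
instance refreshUpdate.isMarkovKernel (κ : Kernel (Ω × P) (Ω × P)) [IsMarkovKernel κ]
    (μP : Measure P) [IsProbabilityMeasure μP] : IsMarkovKernel (refreshUpdate κ μP) := by
  unfold refreshUpdate
  exact Kernel.IsMarkovKernel.map _ measurable_fst

/-! ## Exactness and detailed balance survive refresh-update-forget -/

/-- **Auxiliary-variable updates are exact.**  If the phase-space update `κ` leaves `μ ⊗ μP`
invariant (`μP` a probability law), then refresh–update–forget leaves `μ` invariant:
`fst_* (κ ∘ₘ (μ ⊗ μP)) = fst_* (μ ⊗ μP) = μ`. -/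
theorem refreshUpdate_invariant {κ : Kernel (Ω × P) (Ω × P)} {μ : Measure Ω} [SFinite μ]
    {μP : Measure P} [IsProbabilityMeasure μP] (hκ : Invariant κ (μ.prod μP)) :
    Invariant (refreshUpdate κ μP) μ := by
  change refreshUpdate κ μP ∘ₘ μ = μ
  rw [refreshUpdate, ← Measure.map_comp _ _ measurable_fst, ← Measure.comp_assoc, augment_comp,
    hκ.def]
  exact Measure.fst_prod

/-- Set integrals of the configuration update are phase-space set integrals over cylinders. -/
theorem setLIntegral_refreshUpdate (κ : Kernel (Ω × P) (Ω × P)) (μ : Measure Ω) [SFinite μ]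
    (μP : Measure P) [SFinite μP] {A B : Set Ω} (hA : MeasurableSet A) (hB : MeasurableSet B) :
    ∫⁻ u in A, refreshUpdate κ μP u B ∂μ =
      ∫⁻ z in Prod.fst ⁻¹' A, κ z (Prod.fst ⁻¹' B) ∂(μ.prod μP) := by
  have hpre : (Prod.fst ⁻¹' A : Set (Ω × P)) = A ×ˢ Set.univ := by
    ext z; simp
  have hres : (μ.prod μP).restrict (A ×ˢ Set.univ) = (μ.restrict A).prod μP := by
    rw [← Measure.prod_restrict, Measure.restrict_univ]
  rw [hpre, hres, lintegral_prod _ (Kernel.measurable_coe κ (measurable_fst hB)).aemeasurable]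
  refine setLIntegral_congr_fun hA fun u _ => ?_
  rw [refreshUpdate_apply' κ μP u hB]

/-- **Detailed balance survives refresh–update–forget.**  If `κ` is reversible with respect to
`μ ⊗ μP` then `refreshUpdate κ μP` is reversible with respect to `μ` (test sets `A × P`, `B × P`). -/
theorem refreshUpdate_isReversible {κ : Kernel (Ω × P) (Ω × P)} {μ : Measure Ω} [SFinite μ]
    {μP : Measure P} [SFinite μP] (hκ : IsReversible κ (μ.prod μP)) :
    IsReversible (refreshUpdate κ μP) μ := by
  intro A B hA hB
  rw [setLIntegral_refreshUpdate κ μ μP hA hB, setLIntegral_refreshUpdate κ μ μP hB hA]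
  exact hκ (measurable_fst hA) (measurable_fst hB)

/-- **Reporting commutes with refresh–update–forget** when the field transformation leaves the
auxiliary variable alone: reporting the configuration update through `F` is the configuration
update of the phase-space kernel reported through `F × id` (`TransformedHMC.lean`). -/
theorem conjKernel_refreshUpdate (κ : Kernel (Ω × P) (Ω × P)) (μP : Measure P) [SFinite μP]
    (F : Ω ≃ᵐ Ω) :
    conjKernel (refreshUpdate κ μP) F =
      refreshUpdate (conjKernel κ (F.prodCongr (MeasurableEquiv.refl P))) μP := by
  ext x A hA
  rw [conjKernel_apply' _ _ _ hA, refreshUpdate_apply' _ _ _ (F.measurable hA),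
    refreshUpdate_apply' _ _ _ hA]
  refine lintegral_congr fun π => ?_
  rw [conjKernel_apply' _ _ _ (measurable_fst hA)]
  rfl

/-! ## Normalisation bookkeeping -/

/-- Invariance for `c • μ` and for `μ` are equivalent when `c ≠ 0, ∞`. -/
theorem invariant_smul_iff {κ : Kernel Ω Ω} {μ : Measure Ω} {c : ℝ≥0∞} (h0 : c ≠ 0) (htop : c ≠ ∞) :
    Invariant κ (c • μ) ↔ Invariant κ μ := by
  refine ⟨fun h => ?_, fun h => invariant_smul h c⟩
  have h' := invariant_smul h c⁻¹
  rwa [smul_smul, ENNReal.inv_mul_cancel h0 htop, one_smul] at h'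

/-- The phase-space Boltzmann weight factorises: `e^{−(S(u) + T(π))}·(vol ⊗ volP) =
(e^{−S}·vol) ⊗ (e^{−T}·volP)` (s-finite measures, measurable `S`, `T`). -/
theorem withDensity_exp_neg_add_prod (vol : Measure Ω) (volP : Measure P) [SFinite vol]
    [SFinite volP] {S : Ω → ℝ} {T : P → ℝ} (hS : Measurable S) (hT : Measurable T) :
    (vol.prod volP).withDensity (fun z => ENNReal.ofReal (Real.exp (-(S z.1 + T z.2)))) =
      (vol.withDensity fun u => ENNReal.ofReal (Real.exp (-S u))).prod
        (volP.withDensity fun π => ENNReal.ofReal (Real.exp (-T π))) := by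
  have hf : Measurable fun u => ENNReal.ofReal (Real.exp (-S u)) :=
    ENNReal.measurable_ofReal.comp (Real.measurable_exp.comp hS.neg)
  have hg : Measurable fun π => ENNReal.ofReal (Real.exp (-T π)) :=
    ENNReal.measurable_ofReal.comp (Real.measurable_exp.comp hT.neg)
  rw [prod_withDensity (f := fun u => ENNReal.ofReal (Real.exp (-S u)))
    (g := fun π => ENNReal.ofReal (Real.exp (-T π))) hf hg]
  congr 1
  funext z
  rw [neg_add, Real.exp_add, ENNReal.ofReal_mul (Real.exp_pos _).le]

/-! ## HMC and THMC configuration chains are exact -/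

section Config

variable {vol : Measure Ω} {volP : Measure P} [SFinite vol] [SFinite volP] {S : Ω → ℝ} {T : P → ℝ}
  {Φ : Ω × P → Ω × P} {hΦ : Measurable Φ}

/-- **The HMC configuration update is exact.**  Target `e^{−S}·vol`; kinetic term `T` with
`0 < Z_T = ∫ e^{−T} dvolP < ∞`; momentum law `μP = Z_T⁻¹ e^{−T}·volP`; `Φ` ANY measurable
`vol ⊗ volP`-preserving involution of phase space (MD integrator for `H = S + T` then momentum flip,
at any step size).  Then refresh `π ∼ μP` → propose `Φ` → accept with `min(1, e^{−ΔH})` → forget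
`π` leaves `e^{−S}·vol` invariant. -/
theorem hmc_config_exact (hS : Measurable S) (hT : Measurable T) (hinv : Function.Involutive Φ)
    (hvol : MeasurePreserving Φ (vol.prod volP) (vol.prod volP))
    (hZ0 : volP.withDensity (fun π => ENNReal.ofReal (Real.exp (-T π))) Set.univ ≠ 0)
    (hZtop : volP.withDensity (fun π => ENNReal.ofReal (Real.exp (-T π))) Set.univ ≠ ∞) :
    Invariant
      (refreshUpdate (involMH Φ hΦ fun z : Ω × P => S z.1 + T z.2)
        ((volP.withDensity (fun π => ENNReal.ofReal (Real.exp (-T π))) Set.univ)⁻¹ •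
          volP.withDensity fun π => ENNReal.ofReal (Real.exp (-T π))))
      (vol.withDensity fun u => ENNReal.ofReal (Real.exp (-S u))) := by
  set νT := volP.withDensity fun π => ENNReal.ofReal (Real.exp (-T π)) with hνT
  set Z := νT Set.univ with hZ
  haveI : IsProbabilityMeasure (Z⁻¹ • νT) :=
    ⟨by rw [Measure.smul_apply, smul_eq_mul, ENNReal.inv_mul_cancel hZ0 hZtop]⟩
  -- the skeleton is exact for `e^{−H}·(vol ⊗ volP) = (e^{−S}·vol) ⊗ νT`
  have hH : Measurable fun z : Ω × P => S z.1 + T z.2 :=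
    (hS.comp measurable_fst).add (hT.comp measurable_snd)
  have hinvH := involMH_invariant (vol := vol.prod volP) (hΦ := hΦ) hH hinv hvol
  rw [withDensity_exp_neg_add_prod vol volP hS hT] at hinvH
  -- normalise the momentum factor: `(e^{−S}·vol) ⊗ (Z⁻¹ • νT) = Z⁻¹ • ((e^{−S}·vol) ⊗ νT)`
  have hprod : (vol.withDensity fun u => ENNReal.ofReal (Real.exp (-S u))).prod (Z⁻¹ • νT) =
      Z⁻¹ • (vol.withDensity fun u => ENNReal.ofReal (Real.exp (-S u))).prod νT :=
    Measure.prod_smul_right _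
  refine refreshUpdate_invariant ?_
  rw [hprod]
  exact invariant_smul hinvH _

/-- **THMC as the code runs it is exact.**  Field transformation `F` with positive measurable
Jacobian `J`; on the `V`-variables: refresh `π ∼ Z_T⁻¹e^{−T}·volP`, propose with ANY measurable
`vol ⊗ volP`-preserving involution `Φ` (integrator ∘ flip for the MODIFIED Hamiltonian
`H̃ = (S∘F − log J) + T`), accept with `min(1, e^{−ΔH̃})`, forget `π`, and REPORT `U = F V`.  The
configuration chain so defined leaves `e^{−S(U)}·vol` invariant. -/
theorem thmc_config_exact {F : Ω ≃ᵐ Ω} {J : Ω → ℝ} (hJ : ∀ v, 0 < J v) (hJm : Measurable J)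
    (hF : HasJacobian vol F fun v => ENNReal.ofReal (J v)) (hS : Measurable S) (hT : Measurable T)
    (hinv : Function.Involutive Φ) (hvol : MeasurePreserving Φ (vol.prod volP) (vol.prod volP))
    (hZ0 : volP.withDensity (fun π => ENNReal.ofReal (Real.exp (-T π))) Set.univ ≠ 0)
    (hZtop : volP.withDensity (fun π => ENNReal.ofReal (Real.exp (-T π))) Set.univ ≠ ∞) :
    Invariant
      (conjKernel
        (refreshUpdate (involMH Φ hΦ fun z : Ω × P => (S (F z.1) - Real.log (J z.1)) + T z.2)
          ((volP.withDensity (fun π => ENNReal.ofReal (Real.exp (-T π))) Set.univ)⁻¹ •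
            volP.withDensity fun π => ENNReal.ofReal (Real.exp (-T π))))
        F)
      (vol.withDensity fun u => ENNReal.ofReal (Real.exp (-S u))) := by
  -- HMC for the modified action `S̃ = S∘F − log J` is exact for `e^{−S̃}·vol` …
  have hSt : Measurable fun v => S (F v) - Real.log (J v) :=
    (hS.comp F.measurable).sub (Real.measurable_log.comp hJm)
  have h := hmc_config_exact (vol := vol) (volP := volP) (hΦ := hΦ)
    (S := fun v => S (F v) - Real.log (J v)) hSt hT hinv hvol hZ0 hZtop
  -- … and reporting through `F` turns that into exactness for `e^{−S}·vol`
  exact thmc_exact hJ hF hS h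

end Config

end Summit.Ventures.LatticeQCDFlow.Exactness
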